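import Summits.MatrixMultiplication.MatrixMultiplication.Theorems.AbelianSTPPCensusTC2StatDefs

/-!
# T_C static certificate, range `2881 … 3003` (t*-indexed linear checker with the k-member tree at `τ = 12/5`): kernel evaluation, the shape checks of the tree-heavy volumes `1716`, `1728`, `1755`, `1760`, `1764` on the order sub-range(s) `2923 … 2943` (one theorem per (volume, sub-range): bounded kernel memory)

Cell mm-stpp (rung F-M1), tier T_C = «beat `2.4`»; checker in `AbelianSTPPCensusTC2StatDefs.lean`, table and bucket lists in `AbelianSTPPCensusTC2StatData.lean`
(pattern: theory g12's `AbelianSTPPCensusTAStatDDom*/DCk*.lean`).  `decide` with kernel reduction (standard axioms; no `native_decide`), `Elab.async false`;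
consumed by `TC2Stat.checkV_sound` / `TC2Stat.domV_sound` / `TC2Stat.m2V_sound` in the leaf `AbelianSTPPCensusLeafTC3003Closed.lean`.
WHAT THIS IS NOT: arithmetic on shape lists only; no statement about STPP families or `ω`.
-/

set_option linter.dupNamespace false
set_option autoImplicit false
set_option Elab.async false

namespace Summit.MatrixMultiplication.MatrixMultiplication.Theorems.TC2Stat

set_option maxHeartbeats 0 in
/-- Heavy volume `1716` (27 shapes; 24893 tree nodes over all orders), orders `2923 … 2943`: every sorted candidate shape passes `checkShape 2923 2943`. [original] -/
theorem ck1716r2 : TC2Stat.checkV 2923 2943 1 1716 = true := by decide +kernel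

set_option maxHeartbeats 0 in
/-- Heavy volume `1728` (50 shapes; 204820 tree nodes over all orders), orders `2923 … 2943`: every sorted candidate shape passes `checkShape 2923 2943`. [original] -/
theorem ck1728r2 : TC2Stat.checkV 2923 2943 1 1728 = true := by decide +kernel

set_option maxHeartbeats 0 in
/-- Heavy volume `1755` (15 shapes; 35092 tree nodes over all orders), orders `2923 … 2943`: every sorted candidate shape passes `checkShape 2923 2943`. [original] -/
theorem ck1755r2 : TC2Stat.checkV 2923 2943 1 1755 = true := by decide +kernel

set_option maxHeartbeats 0 in
/-- Heavy volume `1760` (32 shapes; 43635 tree nodes over all orders), orders `2923 … 2943`: every sorted candidate shape passes `checkShape 2923 2943`. [original] -/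
theorem ck1760r2 : TC2Stat.checkV 2923 2943 1 1760 = true := by decide +kernel

set_option maxHeartbeats 0 in
/-- Heavy volume `1764` (39 shapes; 49179 tree nodes over all orders), orders `2923 … 2943`: every sorted candidate shape passes `checkShape 2923 2943`. [original] -/
theorem ck1764r2 : TC2Stat.checkV 2923 2943 1 1764 = true := by decide +kernel

end Summit.MatrixMultiplication.MatrixMultiplication.Theorems.TC2Stat
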